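import Literature.Geometry.Manifold.CoveringSpaceManifold
import Literature.Topology.FourManifolds.SmoothOrientation
import HarnessLib

/-!
# Tangent coordinate changes of the lifted atlas; covering spaces of orientable manifolds are
# orientable (Lee 2012, Prop. 4.40 and Prop. 15.35 / Exercise 15-12)

Companion of `CoveringSpaceManifold.lean` (J. M. Lee, *Introduction to Smooth Manifolds*, 2nd
ed. (2012), Prop. 4.40: the total space `C` of a local homeomorphism `p : C → M` onto a charted
space carries the *lifted atlas* `φ̃ = φ ∘ p|_Ũ`, for which the transition maps are restrictions of
the transition maps of `M`, "`ψ̃ ∘ φ̃⁻¹ = ψ ∘ (π|) ∘ (π|)⁻¹ ∘ φ⁻¹ = ψ ∘ φ⁻¹`").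

We record the infinitesimal form of that sentence and its consequence for orientations:

* `extChartAt_lift_apply`, `extChartAt_lift_symm_apply` — the extended lifted charts are
  `extChartAt (p e) ∘ p` with inverse `(piece of p at e)⁻¹ ∘ (extChartAt (p e))⁻¹`;
* `extChartAt_comp_symm_eventuallyEq_lift` — near the image of a point of the chart domain, the
  change of extended charts `e → e'` of `C` **is** the change of extended charts `p e → p e'` of
  `M` (as germs);
* `tangentCoordChange_lift` — hence their derivatives agree:
  `tangentCoordChange I e e' y = tangentCoordChange I (p e) (p e') (p y)`;
* `SmoothOrientation.lift`, `isOrientable_lift` — **a smooth orientation of `M` lifts to `C`**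
  (`o ∘ p` satisfies the local-constancy axiom of `Literature.Topology.FourManifolds.SmoothOrientation`
  because the Jacobians of the chart changes are the same), so covering spaces (indeed local
  homeomorphisms with the lifted structure) of orientable manifolds are orientable (Lee 2012,
  Prop. 15.35 (d) / Exercise 15-12: "if `π : E → M` is a smooth covering map and `M` is
  orientable, then `E` is orientable").

Everything is proved; no named facts.

## References

* J. M. Lee, *Introduction to Smooth Manifolds*, 2nd ed., GTM 218, Springer (2012/2013),
  Prop. 4.40 (proof), Ch. 15 (orientations of coverings). [LeeSmoothManifolds2013]
-/

noncomputable section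

open scoped Manifold ContDiff Topology
open Function Set Filter OpenPartialHomeomorph

namespace Literature.Geometry.Manifold

/-! ### The extended lifted charts and their changes -/

section Charts

variable {𝕜 : Type*} [NontriviallyNormedField 𝕜] {E : Type*} [NormedAddCommGroup E]
  [NormedSpace 𝕜 E] {H : Type*} [TopologicalSpace H] {I : ModelWithCorners 𝕜 E H}
  {C : Type*} {M : Type*} [TopologicalSpace C] [TopologicalSpace M] [ChartedSpace H M]
  [ChartedSpace H C] {p : C → M}

/-- **The extended lifted chart is `extChartAt (p e) ∘ p`** (Lee's `φ̃ = φ ∘ π|_Ũ`, read through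
the model with corners). [cite: LeeSmoothManifolds2013, Prop. 4.40 (proof)] -/
theorem extChartAt_lift_apply (hp : IsLocalHomeomorph p) {e : C}
    (hchart : chartAt H e = (coveringPiece hp e).trans (chartAt H (p e))) (y : C) :
    extChartAt I e y = extChartAt I (p e) (p y) := by
  simp only [extChartAt, hchart, extend_coe, coe_trans, coe_coveringPiece, comp_apply]

/-- The inverse of the extended lifted chart is `(piece of p at e)⁻¹ ∘ (extChartAt (p e))⁻¹`.
[cite: LeeSmoothManifolds2013, Prop. 4.40 (proof)] -/
theorem extChartAt_lift_symm_apply (hp : IsLocalHomeomorph p) {e : C}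
    (hchart : chartAt H e = (coveringPiece hp e).trans (chartAt H (p e))) (z : E) :
    (extChartAt I e).symm z = (coveringPiece hp e).symm ((extChartAt I (p e)).symm z) := by
  simp only [extChartAt, hchart, extend_coe_symm, coe_trans_symm, comp_apply]

/-- **The chart changes of `C` are the chart changes of `M`** (Lee 2012, proof of Prop. 4.40:
"`ψ̃ ∘ φ̃⁻¹ = ψ ∘ (π|) ∘ (π|)⁻¹ ∘ φ⁻¹ = ψ ∘ φ⁻¹`"): for `y` in the domain of the lifted chart at `e`,
the change of extended charts `e → e'` of `C` agrees, near the coordinate of `y`, with the change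
of extended charts `p e → p e'` of `M` (the two pieces of `p` cancel on the target of the piece
at `e`, an open set containing `p y`). [cite: LeeSmoothManifolds2013, Prop. 4.40 (proof)] -/
theorem extChartAt_comp_symm_eventuallyEq_lift (hp : IsLocalHomeomorph p) {e e' : C}
    (he : chartAt H e = (coveringPiece hp e).trans (chartAt H (p e)))
    (he' : chartAt H e' = (coveringPiece hp e').trans (chartAt H (p e')))
    {y : C} (hy : y ∈ (chartAt H e).source) :
    (extChartAt I e' ∘ (extChartAt I e).symm) =ᶠ[𝓝 (extChartAt I e y)]
      (extChartAt I (p e') ∘ (extChartAt I (p e)).symm) := by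
  have hy' : y ∈ (coveringPiece hp e).source ∧ p y ∈ (chartAt H (p e)).source := by
    rw [he, trans_source, mem_inter_iff, mem_preimage, coe_coveringPiece] at hy
    exact hy
  have hpy : p y ∈ (coveringPiece hp e).target := by
    have h := (coveringPiece hp e).map_source hy'.1
    rwa [coe_coveringPiece] at h
  have hsrc : p y ∈ (extChartAt I (p e)).source := by
    rw [extChartAt_source]
    exact hy'.2
  have hmem : (extChartAt I (p e)).symm ⁻¹' (coveringPiece hp e).target ∈ 𝓝 (extChartAt I e y) := by
    rw [extChartAt_lift_apply hp he]
    exact extChartAt_preimage_mem_nhds' hsrc ((coveringPiece hp e).open_target.mem_nhds hpy)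
  filter_upwards [hmem] with z hz
  simp only [comp_apply, extChartAt_lift_symm_apply hp he, extChartAt_lift_apply hp he']
  have hcancel : p ((coveringPiece hp e).symm ((extChartAt I (p e)).symm z)) =
      (extChartAt I (p e)).symm z := by
    have h := (coveringPiece hp e).right_inv hz
    rwa [coe_coveringPiece] at h
  rw [hcancel]

variable [IsManifold I 1 M] [IsManifold I 1 C] in
/-- **The tangent coordinate changes of the lifted atlas are those of the base**: for `y` in the
domain of the lifted chart at `e`,
`tangentCoordChange I e e' y = tangentCoordChange I (p e) (p e') (p y)` (the derivatives within
`range I` of two maps with the same germ at the same point). [cite: LeeSmoothManifolds2013, Prop. 4.40 (proof)] -/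
theorem tangentCoordChange_lift (hp : IsLocalHomeomorph p) {e e' : C}
    (he : chartAt H e = (coveringPiece hp e).trans (chartAt H (p e)))
    (he' : chartAt H e' = (coveringPiece hp e').trans (chartAt H (p e')))
    {y : C} (hy : y ∈ (chartAt H e).source) :
    tangentCoordChange I e e' y = tangentCoordChange I (p e) (p e') (p y) := by
  rw [tangentCoordChange_def, tangentCoordChange_def, ← extChartAt_lift_apply hp he y]
  have h := extChartAt_comp_symm_eventuallyEq_lift (I := I) hp he he' hy
  exact (h.filter_mono nhdsWithin_le_nhds).fderivWithin_eq h.eq_of_nhds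

end Charts

/-! ### Orientations lift along local homeomorphisms with the lifted structure -/

section Orientation

open Literature.Topology.FourManifolds

variable {E : Type*} [NormedAddCommGroup E] [NormedSpace ℝ E] {H : Type*} [TopologicalSpace H]
  {I : ModelWithCorners ℝ E H}
  {C : Type*} {M : Type*} [TopologicalSpace C] [TopologicalSpace M] [ChartedSpace H M]
  [ChartedSpace H C] [IsManifold I 1 M] [IsManifold I 1 C] {p : C → M}

/-- **The lift `o ∘ p` of a smooth orientation along a local homeomorphism with the lifted
atlas** (Lee 2012, Prop. 15.35 (d) / Exercise 15-12, the pullback orientation of a local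
diffeomorphism): it is locally constant in the sense of `SmoothOrientation` because the Jacobians
of the chart changes of `C` are those of `M` (`tangentCoordChange_lift`).
[cite: LeeSmoothManifolds2013, Prop. 15.35] -/
def _root_.Literature.Topology.FourManifolds.SmoothOrientation.lift (o : SmoothOrientation I M)
    (hp : IsLocalHomeomorph p)
    (hchart : ∀ e : C, chartAt H e = (coveringPiece hp e).trans (chartAt H (p e))) :
    SmoothOrientation I C where
  toFun e := o (p e)
  eventually_eq_iff' e := by
    have h1 := hp.continuous.continuousAt.eventually (o.eventually_eq_iff (p e))
    filter_upwards [h1] with y hy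
    rw [tangentCoordChange_lift hp (hchart y) (hchart e) (mem_chart_source H y)]
    exact hy

/-- The lifted orientation is `o ∘ p`. [cite: LeeSmoothManifolds2013, Prop. 15.35] -/
@[simp] theorem _root_.Literature.Topology.FourManifolds.SmoothOrientation.lift_apply
    (o : SmoothOrientation I M) (hp : IsLocalHomeomorph p)
    (hchart : ∀ e : C, chartAt H e = (coveringPiece hp e).trans (chartAt H (p e))) (e : C) :
    o.lift hp hchart e = o (p e) := rfl

/-- **Covering spaces of orientable manifolds are orientable** (and more generally the total
space of any local homeomorphism onto an orientable manifold, with the lifted smooth structure):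
Lee 2012, Prop. 15.35 (d) / Exercise 15-12. [cite: LeeSmoothManifolds2013, Prop. 15.35] -/
theorem isOrientable_lift (hp : IsLocalHomeomorph p)
    (hchart : ∀ e : C, chartAt H e = (coveringPiece hp e).trans (chartAt H (p e)))
    (hM : IsOrientable I M) : IsOrientable I C := by
  obtain ⟨o⟩ := hM
  exact ⟨o.lift hp hchart⟩

end Orientation

end Literature.Geometry.Manifold

end
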